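import Literature.AlgebraicGeometry.Frobenioids.Thm49RightTransportMultiplicative
import Literature.AlgebraicGeometry.Frobenioids.Thm49FunctorialBaseIsos
import Literature.AlgebraicGeometry.Frobenioids.DivisorMonoidRightEqLeft
import Literature.AlgebraicGeometry.Frobenioids.PullbackLinear
import Literature.AlgebraicGeometry.Frobenioids.Thm49SubII
import HarnessLib

/-!
# [FrdI] Theorem 4.9, row T49-L02 `SufficesRightEqLeft`: PROVED

Mochizuki, *The geometry of Frobenioids I: the general theory*, Kyushu J. Math. **62** (2008)
293–400, §4, proof of Theorem 4.9, kurims p. 89 ll. 6–36 [cite: MochizukiFrdI2008, Thm. 4.9 p.89]: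
"I claim that to complete the proof of Theorem 4.9, it suffices to show that the right-hand and
left-hand isomorphisms of Theorem 4.2, (iii), coincide for all universally Div-Frobenius-trivial
objects … This completes the proof of the claim."

PROOF-ONLY; nothing is defined. `FrdI.T49.sufficesRightEqLeft_holds` closes the typed row
`FrdI.T49.SufficesRightEqLeft` (`Thm49Sub.lean`, seat abc-iut-L1-t14) AS TYPED. Route (the tree's
direct rendering of `Ψ^Φ` by "pre-steps with prescribed zero divisor", Def. 1.3 (iii)(d)):

1. At a universally Div-Frobenius-trivial `O`, the hypothesis `RightEqLeftAt` for every prime yields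
   ONE isomorphism of monoids `Φ₁(O) ≃* Φ₂(ΨO)` satisfying both the right-hand (pre-steps out of `O`)
   and the left-hand (pre-steps into `O`) clause (`FrdI.T49.exists_mulEquiv_of_rightEqLeftAt_family`,
   `DivisorMonoidRightEqLeft.lean`, seat abc-iut-w4-d099); hence the divisor transport `T_O`
   (`exists_divTransport`) is multiplicative and satisfies the left-hand clause
   (`transport_mul_and_leftClause_at`).
2. Extension (p. 89 ll. 9–17 "`Ψ^Prime` extends … functorial in `A₁`"): every object `X` receives a
   pre-step from an object `Y` which admits a pre-step to a Frobenius-trivial — hence universally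
   Div-Frobenius-trivial (Rem. 1.11.1) — object `O` (Def. 1.3 (i)(a)(b)); `T_Y` is multiplicative by
   `transport_mul_of_preStep_to` (window lemma + order rigidity) and then `T_X` by
   `transport_mul_of_preStep_from` (`Thm49RightTransportMultiplicative.lean`):
   `transport_mul_of_forall_rightEqLeftAt`.
3. Objectwise isomorphisms of monoids with the pre-step clause give the full conclusion (both
   functoriality clauses: pull-back morphisms, Prop. 1.11 (v), row T49-L04; base-isomorphisms, row
   T49-L03) by `FrdI.T49.sufficesRightEqLeft_conclusion_of_forall_exists` (`Thm49FunctorialBaseIsos.lean`).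

Also closed here: row T49-L03 `FrdI.T49.SubsetPhiPreserved` (`Thm49SubII.lean`, seat abc-iut-w5-d021)
— it is `PreFrobenioid.exists_divTransport` (seat abc-iut-w4-d099) in the binders of a `T42.Setting`.

The hypotheses "`Ψ^{±1}` preserve primary pre-steps" and the compatibility of `e` with primary pre-steps
into `A` of `SufficesRightEqLeft` are not needed beyond what `RightEqLeftAt … (e A 𝔭)` carries.
Nothing here bears on [IUTchIII].
-/

namespace Literature.AlgebraicGeometry.Frobenioids

open CategoryTheory Opposite

universe w v v' u u'

namespace FrdI.T49

variable {D₁ : Type u} [Category.{v} D₁] {Φ₁ : D₁ᵒᵖ ⥤ CommMonCat.{w}} {C₁ : Type u'}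
  [Category.{v'} C₁] {D₂ : Type u} [Category.{v} D₂] {Φ₂ : D₂ᵒᵖ ⥤ CommMonCat.{w}} {C₂ : Type u'}
  [Category.{v'} C₂] {F₁ : C₁ ⥤ ElemFrobenioid Φ₁} {F₂ : C₂ ⥤ ElemFrobenioid Φ₂} {Ψ : C₁ ≌ C₂}

/-- **Right-hand = left-hand at `O` for the divisor transport.** In a `T42.Setting`, at a universally
Div-Frobenius-trivial `O` where `RightEqLeftAt` holds for every prime (with the primes `e O 𝔭` of the
`Ψ^Prime`-datum `e`), ANY family `T` with the pre-step clause `T_A(Div φ) = Div(Ψφ)` is multiplicative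
at `O` and satisfies the left-hand clause at `O`: `(Ψψ)^* T_O(y) = Div(Ψψ)` whenever `ψ^* y = Div ψ` for
a pre-step `ψ` into `O` (the isomorphism of `exists_mulEquiv_of_rightEqLeftAt_family` agrees with `T_O`
by Def. 1.3 (iii)(d)). [cite: MochizukiFrdI2008, Thm. 4.9 p.89] -/
theorem transport_mul_and_leftClause_at (S : T42.Setting F₁ F₂ Ψ)
    (T : ∀ A : C₁, Φ₁.obj (op (PreFrobenioid.baseObj F₁ A)) →
      Φ₂.obj (op (PreFrobenioid.baseObj F₂ (Ψ.functor.obj A))))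
    (hT : ∀ ⦃A B : C₁⦄ (φ : A ⟶ B), PreFrobenioid.IsPreStep F₁ φ →
      T A (PreFrobenioid.Div F₁ φ) = PreFrobenioid.Div F₂ (Ψ.functor.map φ))
    (e : ∀ A : C₁, Primes (Φ₁.obj (op (PreFrobenioid.baseObj F₁ A))) ≃
      Primes (Φ₂.obj (op (PreFrobenioid.baseObj F₂ (Ψ.functor.obj A)))))
    (hRL : ∀ (A : C₁), PreFrobenioid.IsUniversallyDivFrobeniusTrivial F₁ A →
      ∀ 𝔭 : Primes (Φ₁.obj (op (PreFrobenioid.baseObj F₁ A))), RightEqLeftAt F₁ F₂ Ψ A 𝔭 (e A 𝔭))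
    {O : C₁} (hO : PreFrobenioid.IsUniversallyDivFrobeniusTrivial F₁ O) :
    (∀ a b, T O (a * b) = T O a * T O b) ∧
      ∀ ⦃W : C₁⦄ (ψ : W ⟶ O), PreFrobenioid.IsPreStep F₁ ψ →
        ∀ y : Φ₁.obj (op (PreFrobenioid.baseObj F₁ O)),
          pull Φ₁ (PreFrobenioid.Base F₁ ψ) y = PreFrobenioid.Div F₁ ψ →
            pull Φ₂ (PreFrobenioid.Base F₂ (Ψ.functor.map ψ)) (T O y) =
              PreFrobenioid.Div F₂ (Ψ.functor.map ψ) := by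
  obtain ⟨M, hMR, hML⟩ := exists_mulEquiv_of_rightEqLeftAt_family S e hRL hO
  -- `T_O = M` by "pre-steps with prescribed zero divisor" (Def. 1.3 (iii)(d))
  have hTM : ∀ x, T O x = M x := by
    intro x
    obtain ⟨B, φ, hφ, hφx⟩ := S.isFrobenioid₁.iii_d_under_surj O x
    rw [← hφx, hT φ hφ.2, hMR φ hφ.2]
  refine ⟨fun a b => by rw [hTM, hTM, hTM, map_mul], fun W ψ hψ y hy => ?_⟩
  rw [hTM]
  exact hML ψ hψ y hy

/-- **The divisor transport is multiplicative at EVERY object** (the extension step, p. 89 ll. 9–17),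
given `RightEqLeftAt` for all primes at every universally Div-Frobenius-trivial object: Def. 1.3
(i)(a)(b) give, for any `X`, a Frobenius-trivial (hence universally Div-Frobenius-trivial, Rem. 1.11.1)
`O` and pre-steps `Y → X`, `Y → O`; then `PreFrobenioid.transport_mul_of_preStep_to` at `Y` and
`PreFrobenioid.transport_mul_of_preStep_from` along `Y → X`. [cite: MochizukiFrdI2008, Thm. 4.9 p.89] -/
theorem transport_mul_of_forall_rightEqLeftAt (S : T42.Setting F₁ F₂ Ψ)
    (T : ∀ A : C₁, Φ₁.obj (op (PreFrobenioid.baseObj F₁ A)) →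
      Φ₂.obj (op (PreFrobenioid.baseObj F₂ (Ψ.functor.obj A))))
    (hTb : ∀ A, Function.Bijective (T A)) (hTd : ∀ A (x y), x ∣ y ↔ T A x ∣ T A y)
    (hT : ∀ ⦃A B : C₁⦄ (φ : A ⟶ B), PreFrobenioid.IsPreStep F₁ φ →
      T A (PreFrobenioid.Div F₁ φ) = PreFrobenioid.Div F₂ (Ψ.functor.map φ))
    (e : ∀ A : C₁, Primes (Φ₁.obj (op (PreFrobenioid.baseObj F₁ A))) ≃
      Primes (Φ₂.obj (op (PreFrobenioid.baseObj F₂ (Ψ.functor.obj A)))))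
    (hRL : ∀ (A : C₁), PreFrobenioid.IsUniversallyDivFrobeniusTrivial F₁ A →
      ∀ 𝔭 : Primes (Φ₁.obj (op (PreFrobenioid.baseObj F₁ A))), RightEqLeftAt F₁ F₂ Ψ A 𝔭 (e A 𝔭))
    (X : C₁) (a b : Φ₁.obj (op (PreFrobenioid.baseObj F₁ X))) : T X (a * b) = T X a * T X b := by
  have hF₁ := S.isFrobenioid₁
  -- a Frobenius-trivial `O` over (an isomorph of) the base of `X`, and a span of pre-steps `X ← Y → O`
  obtain ⟨O, hOft, ⟨α⟩⟩ := hF₁.i_a (PreFrobenioid.baseObj F₁ X)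
  obtain ⟨Y, φ, ψ, hφ, hψ, -⟩ := hF₁.i_b X O α.symm
  have hO : PreFrobenioid.IsUniversallyDivFrobeniusTrivial F₁ O :=
    PreFrobenioid.IsFrobeniusTrivial.isUniversallyDivFrobeniusTrivial hF₁ hOft
  obtain ⟨hmulO, hRLO⟩ := transport_mul_and_leftClause_at S T hT e hRL hO
  have hmulY : ∀ a b, T Y (a * b) = T Y a * T Y b :=
    PreFrobenioid.transport_mul_of_preStep_to Ψ hF₁ S.isFrobenioid₂ S.perfect₁ S.isotropic₁
      S.perfFactorial₁ S.preStep_map T hTb hTd hT hmulO hRLO ψ hψ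
  exact PreFrobenioid.transport_mul_of_preStep_from Ψ hF₁ S.isFrobenioid₂ S.preStep_map T hT φ hφ
    hmulY a b

/-- **[FrdI] Thm. 4.9, proof step T49-L02 (`SufficesRightEqLeft`), PROVED AS TYPED**: "it suffices to
show that the right-hand and left-hand isomorphisms of Theorem 4.2, (iii), coincide for all
universally Div-Frobenius-trivial objects" (p. 89 ll. 6–36). In a `T42.Setting`, given the
`Ψ^Prime`-datum `e` and `RightEqLeftAt` at every universally Div-Frobenius-trivial object and every
prime, the divisor transports `T_A : Φ₁(A) → Φ₂(ΨA)` (Def. 1.3 (iii)(d), `exists_divTransport`) are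
isomorphisms of monoids at EVERY `A` (`transport_mul_of_forall_rightEqLeftAt`), computing `Div ∘ Ψ`
on pre-steps; both functoriality clauses follow (rows T49-L03/L04,
`sufficesRightEqLeft_conclusion_of_forall_exists`). [cite: MochizukiFrdI2008, Thm. 4.9 p.89] -/
theorem sufficesRightEqLeft_holds : SufficesRightEqLeft.{w, v, v', u, u'} := by
  intro D₁ _ Φ₁ C₁ _ D₂ _ Φ₂ C₂ _ F₁ F₂ Ψ S _ _ e _ hRL
  choose T hTb hTd hT using fun A : C₁ => PreFrobenioid.exists_divTransport Ψ S.isFrobenioid₁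
    S.isFrobenioid₂ S.isotropic₁ S.isotropic₂ S.preStep_map S.preStep_inv A
  have hT' : ∀ ⦃A B : C₁⦄ (φ : A ⟶ B), PreFrobenioid.IsPreStep F₁ φ →
      T A (PreFrobenioid.Div F₁ φ) = PreFrobenioid.Div F₂ (Ψ.functor.map φ) :=
    fun A _ φ hφ => hT A φ hφ
  have hmul := transport_mul_of_forall_rightEqLeftAt S T hTb hTd hT' e hRL
  refine sufficesRightEqLeft_conclusion_of_forall_exists S fun A => ?_
  have h1 : T A 1 = 1 := map_one_of_dvd_iff
    (S.isFrobenioid₂.isPreFrobenioid.isDivisorial _).isSharp (T A) (hTb A).2 (hTd A)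
  let Tm : Φ₁.obj (op (PreFrobenioid.baseObj F₁ A)) →*
      Φ₂.obj (op (PreFrobenioid.baseObj F₂ (Ψ.functor.obj A))) :=
    { toFun := T A, map_one' := h1, map_mul' := hmul A }
  exact ⟨MulEquiv.ofBijective Tm (hTb A), fun B φ hφ => hT A φ hφ⟩

/-- **Row T49-L03 `SubsetPhiPreserved`, PROVED AS TYPED** ("maps the subset `Φ₁(A₁)` onto the subset
`Φ₂(A₂)`", p. 89 ll. 25–33, rendered objectwise): in a `T42.Setting` the transport "pre-steps with
prescribed zero divisor" `Div φ ↦ Div(Ψφ)` is a bijection `Φ₁(A) → Φ₂(ΨA)` compatible with `≤` —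
`PreFrobenioid.exists_divTransport` (`DivisorMonoidTransport.lean`, seat abc-iut-w4-d099).
[cite: MochizukiFrdI2008, Thm. 4.9 p.89] -/
theorem subsetPhiPreserved_holds : SubsetPhiPreserved.{w, v, v', u, u'} :=
  fun _F₁ _F₂ Ψ S A => PreFrobenioid.exists_divTransport Ψ S.isFrobenioid₁ S.isFrobenioid₂ S.isotropic₁
    S.isotropic₂ S.preStep_map S.preStep_inv A

end FrdI.T49

end Literature.AlgebraicGeometry.Frobenioids
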